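import Summits.HodgeConjecture.HodgeConjecture.Theses.VHCAbelianSchemesRoad
import Summits.HodgeConjecture.HodgeConjecture.Theorems.VHCAbelianSchemesRoadSecantQuotientAnchorPinnedDefs
import HarnessLib

/-!
# BC3 birth skeleton v3.1 (the `(6,3)` anchor stubs of v3 RE-POSED AT THE PINNED POLARISATION `θ = e^*h_Y(θ₀)`; nothing else moves) for the crux
# `SemiregularSheafRepresentativesTwAtDiag` of route `VHCAbelianSchemesRoad` — ring2 LEAD gen 153 (planner-pub-hodge-ring2-typer1-g151-0,
# tenure planner of the route, skeleton custodian D-0059), 2026-08-27; ruling L153.1a (ring2 INBOX l.5003: b02 g88's v3.1 CALL = GO, LEAD the one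
# registrant), design memo of LEAD gen 152 (`tools-g152/session/crux/V31_DESIGN.md`), J conditions of `j-note-rev15-L1514-concur-g28.md` §4 and
# C1/C2/C3 of `j-preread-v3-shape-g26.md` carried over unchanged (a skeleton re-registration is items-level: crux text, `closes`, binders UNTOUCHED; no round).

research route conditional on HC_CM; not a corollary; Q11.4-sentence-2 already refuted in dim ≥ 3.

WHAT CHANGED FROM v3 (md5 c490560c…, sha16 dcfb71156c3b06fb, tree commit 6ce9d38a51b1; card rev 2 292db53decb4): the two `(6,3)` stubs are re-posed over the
PINNED anchor data of `Theorems/VHCAbelianSchemesRoadSecantQuotientAnchorPinnedDefs.lean` (`secantQuotientAnchorsPinned X θ` ∕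
`secantQuotientServedClassesPinned X θ` = v3's geometric secant–quotient anchor clauses VERBATIM plus the PIN «`e⁻¹^*θ = h_Y(θ₀)` for a
polarisation class `θ₀ ∈ ℚˣ·[Θ]`», `h_Y(θ₀)` the descent to `Y_d = (J × Ĵ)/Ḡ` of Markman's `Ξ_d(θ₀) = p₁^*θ₀ + d·p₂^*θ̂₀`, typed in closed form by
the carriers file `Literature/AlgebraicGeometry/Markman2025/SecantQuotientPolarization` p507939) — closing road gap (G2) «polarisation class» at
statement level, the gap b02 g88's pinned object-level claim-fact `HodgeTheory.Markman2025_secantQuotient_twistedCarrier_onJacobian_pinned`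
(p510628, PREPRINT arXiv:2502.03415, under review) is stated at:
* `stub_anchorCarrier_63_secantQuotientPinned : ∀ C, SecantQuotientAnchorCarrier63Pinned C` (2a″ = (a″): an `AdmTw`-twisted carrier pinned to
  every PINNED-served class at every PINNED anchor; implied by v3's (a′) (`secantQuotientAnchorCarrier63Pinned_of_secantQuotientAnchorCarrier63`:
  fewer anchors and classes); CITATION-EXPECTED from Thm 1.4.1 + §1.5 + Lemma 9.3.11 + Remark 9.3.7 at print's anchors in print's direction modulo
  the pinned claim-fact — its sub-case «an anchored datum at print's own pinned anchor» LANDED before registration as b02 g88's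
  `exists_anchoredDatum_secantQuotientPinned_of_pinned` (P1″ file `Theorems/VHCAbelianSchemesRoadSecantQuotientAnchorPinnedMarkman.lean` p513733, modulo
  the claim-tagged L1″ p510628); the stub itself OPEN beyond by the remaining typed gaps (G1) genericity of `C` and (G3) served directions; first
  prover target of record) and
* `stub_residual_63_secantQuotientPinned : ∀ C, SecantQuotientResidual63Pinned C` (2b″ = (b″): the cell `(6,3)` on the pencils with NO
  PINNED-served fibre — a LARGER family than v3's (b′): (b″) ⟹ (b′) (`secantQuotientResidual63_of_secantQuotientResidual63Pinned`), converse not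
  claimed; contains the very general NON-SPLIT `(6,3)` Weil-type pencils = the separating content; PROPOSED T3 PLAN-ONLY rung-designate as before),
and `rung_sixfoldMiddleTw` (statement byte-identical to v2's stub and v3's theorem) := the fact-free glue
`rung_sixfoldMiddleTw_of_secantQuotientAnchorCarrier63Pinned_of_residual63Pinned` applied to 2a″, 2b″. HONEST BOOKKEEPING: the pin moves content from
the citation-expected half (a) to the research half (b); the conjunction (a″) ∧ (b″) still gives the rung and the rung still gives (b″) fact-free
(`secantQuotientResidual63Pinned_of_rung_sixfoldMiddleTw`), so C2 (non-vacuity) reads exactly as for v3: (a″) is NOT a fact-free theorem, (b″) is NOT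
kernel-equivalent to the rung, and the crux returns every stub but 2a″. `stub_firstCell_fourfoldMiddleTw`, `stub_diagonalTailTw`,
`SemiregularSheafRepresentativesTwAtDiag_of_cells` and `SemiregularSheafRepresentativesTwAtDiag_of` are BYTE-IDENTICAL to v3 (and v2);
`_of` is hypothesis-free and concludes the ROUTE DECL BY NAME (L150.1).
Nothing here says any cell, carrier, residual, design, VHC, HC_AV, HC_CM or HC holds; sorries live ONLY in the four `stub_*`.
-/

noncomputable section

open Literature.AlgebraicGeometry.HodgeTheory (ChernCharacterBetti)
open Summit.HodgeConjecture.HodgeConjecture.Ring2.SemiregularRepresentatives (LefAtExceptionalRegimeAt LefAtExceptionalRegimeSixfoldMiddle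
  lefAtExceptionalRegimeSixfoldMiddle_iff_at SecantQuotientAnchorCarrier63Pinned SecantQuotientResidual63Pinned
  rung_sixfoldMiddleTw_of_secantQuotientAnchorCarrier63Pinned_of_residual63Pinned secantQuotientResidual63Pinned_of_rung_sixfoldMiddleTw)

namespace Summit.HodgeConjecture.HodgeConjecture.Cruxes.SemiregularSheafRepresentativesTwAtDiag.BirthDiag

set_option linter.dupNamespace false

/-! ## The v3.1 skeleton proper -/

/-- STUB 1 (size XL, research; MECHANISM cell): regime 2 over the twisted door at `(4, 2)` — abelian fourfold pencils, codimension 2. -/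
theorem stub_firstCell_fourfoldMiddleTw : ∀ C : ChernCharacterBetti,
    LefAtExceptionalRegimeAt (Literature.AlgebraicGeometry.HodgeTheory.twistedReflexiveClass C (fun n X₀ I E => Summit.Ventures.HSemireg.gluableSigmaAdmissible n X₀ I E ∨ Literature.AlgebraicGeometry.HodgeTheory.bfSingleAdmissible n X₀ I E)) 4 2 := by
  sorry

/-- STUB 2a″ (size L; CITATION-EXPECTED at print's anchors, PREPRINT-GATED; OPEN beyond gaps (G1), (G3)): the PINNED ANCHORED CARRIER at `(6, 3)` —
at every PINNED secant–quotient anchor `(X, θ)` (a chart `e` of `Y_d = (J(C) × Ĵ)/Ḡ`, `d` even `≥ 4`, with `θ = e^*h_Y(θ₀)`, `θ₀ ∈ ℚˣ·[Θ]`,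
`h_Y(θ₀)` the descent of `Ξ_d(θ₀) = p₁^*θ₀ + d·p₂^*θ̂₀`) and every pinned-served rational class `γ ∈ ℂθ³ ⊕ (Weil plane)` off the ray, an
`AdmTw`-admissible `B`-twisted bounded complex of vector bundles on `X` with `κ₃ = a·γ + c·θ³`, `a ≠ 0` (Markman's secant⁻¹-line twisted
semiregular reflexive sheaf `𝓔̄` on `Y_d`, arXiv:2502.03415 Thm 1.4.1 ∕ §1.5 ∕ Lemma 9.3.11 ∕ Remark 9.3.7, unrefereed). Implied by v3's 2a′;
not a fact-free theorem (anchors are INPUT data, not «X carries a datum»). -/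
theorem stub_anchorCarrier_63_secantQuotientPinned : ∀ C : ChernCharacterBetti, SecantQuotientAnchorCarrier63Pinned C := by
  sorry

/-- STUB 2b″ = PROPOSED BC5 PLAN-ONLY RUNG-DESIGNATE (size XL; the SEPARATING content): regime 2 at `(6, 3)` over the twisted door for the
abelian sixfold pencils with NO PINNED-served secant–quotient fibre (`¬ HasServedFibre 6 3 secantQuotientAnchorsPinned secantQuotientServedClassesPinned f W`)
— the very general NON-SPLIT `(3, d, δ)` Weil-type pencils (`δ ≠ [−1]`, class target open in print), split-Weil pencils missing every copy of
every `Y_d`, pencils served only at an un-pinned polarisation, odd-rank product sub-loci, CM cells (binder territory), unserved directions.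
Implies v3's 2b′; implied by the rung fact-free; NOT known to imply it. -/
theorem stub_residual_63_secantQuotientPinned : ∀ C : ChernCharacterBetti, SecantQuotientResidual63Pinned C := by
  sorry

/-- STUB 3 (size XL, research; the TAIL): regime 2 over the twisted door at every diagonal cell `(2m, m)`, `m ≥ 4` — no print contact. -/
theorem stub_diagonalTailTw : ∀ (C : ChernCharacterBetti) (m : ℕ), 4 ≤ m →
    LefAtExceptionalRegimeAt (Literature.AlgebraicGeometry.HodgeTheory.twistedReflexiveClass C (fun n X₀ I E => Summit.Ventures.HSemireg.gluableSigmaAdmissible n X₀ I E ∨ Literature.AlgebraicGeometry.HodgeTheory.bfSingleAdmissible n X₀ I E)) (2 * m) m := by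
  sorry

/-- The `(6, 3)` RUNG (statement byte-identical to v2's `stub_rung_sixfoldMiddleTw` and v3's theorem), a THEOREM from STUB 2a″ + STUB 2b″ via the
fact-free glue `rung_sixfoldMiddleTw_of_secantQuotientAnchorCarrier63Pinned_of_residual63Pinned` (sorryAx reaches it only through the two stubs). -/
theorem rung_sixfoldMiddleTw : ∀ C : ChernCharacterBetti, LefAtExceptionalRegimeSixfoldMiddle (Literature.AlgebraicGeometry.HodgeTheory.twistedReflexiveClass C (fun n X₀ I E => Summit.Ventures.HSemireg.gluableSigmaAdmissible n X₀ I E ∨ Literature.AlgebraicGeometry.HodgeTheory.bfSingleAdmissible n X₀ I E)) :=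
  rung_sixfoldMiddleTw_of_secantQuotientAnchorCarrier63Pinned_of_residual63Pinned stub_anchorCarrier_63_secantQuotientPinned
    stub_residual_63_secantQuotientPinned

/-- **BC3 composition, hypothesis form** — the three cell-stubs' STATEMENTS give the crux's statement (case split on `m`; the rung
enters at `m = 3` through `lefAtExceptionalRegimeSixfoldMiddle_iff_at = Iff.rfl`). Pure logic, no sorry. Its conclusion is the crux decl's
statement SPELLED OUT, not the decl's name, so that the A12 skeleton audit does not take this hypothesis-form lemma for the skeleton theorem
(v2, LEAD gen 150: `checkSkeletonCore` audits the environment's FIRST theorem headed by the crux decl and admits only registered obligations as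
its hypotheses — the g149 file's `_of` with `h₁ h₂ h₃` was that first theorem ⇒ `skeleton.extra-hypothesis` ×3, rc 20, 2026-08-27T00:51:11Z). -/
theorem SemiregularSheafRepresentativesTwAtDiag_of_cells
    (h₁ : ∀ C : ChernCharacterBetti,
      LefAtExceptionalRegimeAt (Literature.AlgebraicGeometry.HodgeTheory.twistedReflexiveClass C (fun n X₀ I E => Summit.Ventures.HSemireg.gluableSigmaAdmissible n X₀ I E ∨ Literature.AlgebraicGeometry.HodgeTheory.bfSingleAdmissible n X₀ I E)) 4 2)
    (h₂ : ∀ C : ChernCharacterBetti,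
      LefAtExceptionalRegimeSixfoldMiddle (Literature.AlgebraicGeometry.HodgeTheory.twistedReflexiveClass C (fun n X₀ I E => Summit.Ventures.HSemireg.gluableSigmaAdmissible n X₀ I E ∨ Literature.AlgebraicGeometry.HodgeTheory.bfSingleAdmissible n X₀ I E)))
    (h₃ : ∀ (C : ChernCharacterBetti) (m : ℕ), 4 ≤ m →
      LefAtExceptionalRegimeAt (Literature.AlgebraicGeometry.HodgeTheory.twistedReflexiveClass C (fun n X₀ I E => Summit.Ventures.HSemireg.gluableSigmaAdmissible n X₀ I E ∨ Literature.AlgebraicGeometry.HodgeTheory.bfSingleAdmissible n X₀ I E)) (2 * m) m) :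
    ∀ (C : ChernCharacterBetti) (m : ℕ), 2 ≤ m →
      LefAtExceptionalRegimeAt (Literature.AlgebraicGeometry.HodgeTheory.twistedReflexiveClass C (fun n X₀ I E => Summit.Ventures.HSemireg.gluableSigmaAdmissible n X₀ I E ∨ Literature.AlgebraicGeometry.HodgeTheory.bfSingleAdmissible n X₀ I E)) (2 * m) m := by
  intro C m hm
  rcases Nat.lt_or_ge m 4 with hlt | hge
  · interval_cases m
    · exact h₁ C
    · exact (lefAtExceptionalRegimeSixfoldMiddle_iff_at.1 (h₂ C))
  · exact h₃ C m hge

/-- **BC3 composition** — concludes the ROUTE DECL BY NAME from the four DECLARED stubs (through the theorem `rung_sixfoldMiddleTw`); no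
hypothesis; `sorryAx` reaches it only through `stub_*`, so it is NOT closed — as designed — until the stubs land. -/
theorem SemiregularSheafRepresentativesTwAtDiag_of :
    Summit.HodgeConjecture.HodgeConjecture.Theses.VHCAbelianSchemesRoad.SemiregularSheafRepresentativesTwAtDiag := by
  intro C m hm
  exact SemiregularSheafRepresentativesTwAtDiag_of_cells stub_firstCell_fourfoldMiddleTw rung_sixfoldMiddleTw stub_diagonalTailTw C m hm

#print axioms SemiregularSheafRepresentativesTwAtDiag_of_cells
#print axioms SemiregularSheafRepresentativesTwAtDiag_of

end Summit.HodgeConjecture.HodgeConjecture.Cruxes.SemiregularSheafRepresentativesTwAtDiag.BirthDiag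

end
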